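import Mathlib

/-!
# `ThresholdSubsetTriples` (crux stmt-MatrixMultiplication-10882), line `SketchIdeator6`:
# necessary conditions every GENUS-CERTIFIED design must survive

Negative-side helper (line lead c6, 2026-08-17; `sorry`-free, standard axioms).  The design stub
`stub_genusThreshold` of the line asks for triples `S, T, U ⊆ S_n` whose non-trivial quotients
`q₁ = s s'⁻¹, q₂ = t t'⁻¹, q₃ = u u'⁻¹` always satisfy the genus certificate
`n + 2·orb⟨q₁,q₂,q₃⟩ < cyc q₁ + cyc q₂ + cyc q₃` (`cyc` = orbits of `⟨q⟩` incl. fixed points,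
`orb` = orbits of the subgroup generated by all three).  Writing `ℓ = n − cyc` (Cayley length) and
`rk = n − orb` (rank of the union of the three cycle forests) the certificate reads `ℓ₁ + ℓ₂ + ℓ₃ < 2·rk`.
This file records, as tree lemmas, the two cheapest VIOLATION TEMPLATES — the tests a design for the
stub must pass, and the handles a disproof of the stub can pull:

* `three_le_cyc_add` (**N1, the cycle-count inequality**): a certified triple of quotients has
  `n + 3 ≤ cyc q₁ + cyc q₂ + cyc q₃` (because `orb ≥ 1`); equivalently `ℓ₁ + ℓ₂ + ℓ₃ ≤ 2n − 3`.  Hence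
  `L_S + L_T + L_U ≤ 2n − 3` for the maximal quotient lengths: one of the three sets is an anticode of
  Cayley diameter `< 2n/3`, and a single "generic" pair in two of the sets (quotients with `O(log n)`
  cycles) confines the third set to Cayley diameter `O(log n)`.
* `card_orbitQuotient_closure_eq_of_forall_mem_orbit` (**alignment collapses the rank**): if every
  generator in `s` maps each point into its `⟨p⟩`-orbit (`p ∈ s`), the group generated by `s` has
  exactly the orbits of `⟨p⟩`, so `orb⟨s⟩ = cyc p`.
* `not_genusCertificate_of_aligned` (**template D/E**): if `q₁` and `q₃` preserve every cycle of `q₂`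
  and `cyc q₃ ≤ cyc q₂` (e.g. `q₂, q₃` have the SAME cycle partition and `q₁` lives inside its blocks —
  in particular three quotients with one common cycle partition), the certificate fails.  For sets:
  `genusCertificate_cyc_lt_of_aligned` — in a certified triple, whenever a quotient of `S` and a
  quotient of `U` both preserve the cycles of a quotient `q₂` of `T`, the `U`-quotient has STRICTLY MORE
  cycles than `q₂`.

All statements are about three permutations of `Fin n` and the inlined quantities of the stub
(`Nat.card (MulAction.orbitRel.Quotient (Subgroup.zpowers q) (Fin n))`,
`Nat.card (MulAction.orbitRel.Quotient (Subgroup.closure {q₁,q₂,q₃}) (Fin n))`), so they apply to the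
registered signature verbatim.  References: crux workfiles `Lines/SketchIdeator6.lean` (skeleton v4),
`Census-a4-GenusCertificate.md` (D1, N1); Lando–Zvonkin, *Graphs on Surfaces* Ch. 1 (genus of a
constellation).
-/

set_option linter.dupNamespace false

namespace Summit.MatrixMultiplication.MatrixMultiplication.Theorems.ThresholdSubsetTriples.Negative

open MulAction

variable {n : ℕ}

/-- An orbit quotient of `Fin n` has at most `n` classes: `cyc q ≤ n`, `orb ≤ n`. -/
theorem card_orbitQuotient_le (H : Subgroup (Equiv.Perm (Fin n))) :
    Nat.card (orbitRel.Quotient H (Fin n)) ≤ n := by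
  have h := Nat.card_le_card_of_surjective
    (Quotient.mk (orbitRel H (Fin n)) : Fin n → orbitRel.Quotient H (Fin n)) Quotient.mk_surjective
  simpa using h

/-- An orbit quotient of `Fin n`, `0 < n`, has at least one class: `1 ≤ orb`. -/
theorem one_le_card_orbitQuotient (H : Subgroup (Equiv.Perm (Fin n))) (hn : 0 < n) :
    1 ≤ Nat.card (orbitRel.Quotient H (Fin n)) := by
  haveI : Nonempty (orbitRel.Quotient H (Fin n)) := ⟨Quotient.mk _ ⟨0, hn⟩⟩
  exact Nat.one_le_iff_ne_zero.mpr Nat.card_pos.ne'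

/-- **N1 (cycle-count inequality).**  If a triple of permutations of `Fin n` passes the genus
certificate `n + 2·orb⟨q₁,q₂,q₃⟩ < cyc q₁ + cyc q₂ + cyc q₃`, then `n + 3 ≤ cyc q₁ + cyc q₂ + cyc q₃`,
i.e. `ℓ(q₁) + ℓ(q₂) + ℓ(q₃) ≤ 2n − 3` for the Cayley lengths `ℓ = n − cyc`. -/
theorem three_le_cyc_add (q₁ q₂ q₃ : Equiv.Perm (Fin n))
    (h : n + 2 * Nat.card (orbitRel.Quotient
        (Subgroup.closure ({q₁, q₂, q₃} : Set (Equiv.Perm (Fin n)))) (Fin n)) <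
      Nat.card (orbitRel.Quotient (Subgroup.zpowers q₁) (Fin n)) +
      Nat.card (orbitRel.Quotient (Subgroup.zpowers q₂) (Fin n)) +
      Nat.card (orbitRel.Quotient (Subgroup.zpowers q₃) (Fin n))) :
    n + 3 ≤ Nat.card (orbitRel.Quotient (Subgroup.zpowers q₁) (Fin n)) +
      Nat.card (orbitRel.Quotient (Subgroup.zpowers q₂) (Fin n)) +
      Nat.card (orbitRel.Quotient (Subgroup.zpowers q₃) (Fin n)) := by
  rcases Nat.eq_zero_or_pos n with hn | hn
  · subst hn
    have h₁ := card_orbitQuotient_le (Subgroup.zpowers q₁)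
    have h₂ := card_orbitQuotient_le (Subgroup.zpowers q₂)
    have h₃ := card_orbitQuotient_le (Subgroup.zpowers q₃)
    omega
  · have h0 := one_le_card_orbitQuotient
      (Subgroup.closure ({q₁, q₂, q₃} : Set (Equiv.Perm (Fin n)))) hn
    omega

/-- **N1, contrapositive with the trivial upper bounds.**  Since `cyc q ≤ n`, a certified triple has
`cyc q₂ + cyc q₃ ≥ 3 + (n − cyc q₁)`: a quotient with few cycles in one set (e.g. an `n`-cycle,
`cyc = 1`) forces the quotients of the other two sets to have many (`cyc q₂ + cyc q₃ ≥ n + 2`). -/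
theorem cyc_add_cyc_ge_of_genusCertificate (q₁ q₂ q₃ : Equiv.Perm (Fin n))
    (h : n + 2 * Nat.card (orbitRel.Quotient
        (Subgroup.closure ({q₁, q₂, q₃} : Set (Equiv.Perm (Fin n)))) (Fin n)) <
      Nat.card (orbitRel.Quotient (Subgroup.zpowers q₁) (Fin n)) +
      Nat.card (orbitRel.Quotient (Subgroup.zpowers q₂) (Fin n)) +
      Nat.card (orbitRel.Quotient (Subgroup.zpowers q₃) (Fin n))) :
    n + 3 ≤ Nat.card (orbitRel.Quotient (Subgroup.zpowers q₁) (Fin n)) +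
      (Nat.card (orbitRel.Quotient (Subgroup.zpowers q₂) (Fin n)) +
      Nat.card (orbitRel.Quotient (Subgroup.zpowers q₃) (Fin n))) ∧
    Nat.card (orbitRel.Quotient (Subgroup.zpowers q₁) (Fin n)) ≤ n := by
  have h3 := three_le_cyc_add q₁ q₂ q₃ h
  have h₁ := card_orbitQuotient_le (Subgroup.zpowers q₁)
  exact ⟨by omega, h₁⟩

/-- `p` maps every point into its own `⟨p⟩`-orbit. -/
theorem apply_mem_orbit_zpowers (p : Equiv.Perm (Fin n)) (x : Fin n) :
    p x ∈ orbit (Subgroup.zpowers p) x :=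
  mem_orbit x (⟨p, Subgroup.mem_zpowers p⟩ : Subgroup.zpowers p)

/-- **Alignment collapses the rank.**  If `p ∈ s` and every generator `q ∈ s` maps each point into
its `⟨p⟩`-orbit (i.e. preserves every cycle of `p` set-wise), then the subgroup generated by `s` has
exactly the orbits of `⟨p⟩`: `orb⟨s⟩ = cyc p`. -/
theorem card_orbitQuotient_closure_eq_of_forall_mem_orbit {s : Set (Equiv.Perm (Fin n))}
    {p : Equiv.Perm (Fin n)} (hp : p ∈ s)
    (hs : ∀ q ∈ s, ∀ x : Fin n, q x ∈ orbit (Subgroup.zpowers p) x) :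
    Nat.card (orbitRel.Quotient (Subgroup.closure s) (Fin n)) =
      Nat.card (orbitRel.Quotient (Subgroup.zpowers p) (Fin n)) := by
  -- every element of the closure preserves the `⟨p⟩`-orbits
  have key : ∀ g ∈ Subgroup.closure s, ∀ x : Fin n, g x ∈ orbit (Subgroup.zpowers p) x := by
    intro g hg
    refine Subgroup.closure_induction (p := fun g _ => ∀ x : Fin n, g x ∈ orbit (Subgroup.zpowers p) x)
      (fun q hq => hs q hq) (fun x => by simp) ?_ ?_ hg
    · intro a b _ _ ha hb x
      have hbx : orbit (Subgroup.zpowers p) (b x) = orbit (Subgroup.zpowers p) x :=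
        orbit_eq_iff.mpr (hb x)
      have := ha (b x)
      rw [hbx] at this
      simpa [Equiv.Perm.mul_apply] using this
    · intro a _ ha x
      have h1 : a (a.symm x) ∈ orbit (Subgroup.zpowers p) (a.symm x) := ha (a.symm x)
      rw [Equiv.apply_symm_apply] at h1
      -- `x ∈ orbit (a⁻¹ x)`, hence the orbits agree and `a⁻¹ x ∈ orbit x`
      have h2 : orbit (Subgroup.zpowers p) x = orbit (Subgroup.zpowers p) (a.symm x) :=
        orbit_eq_iff.mpr h1
      rw [Equiv.Perm.coe_inv, h2]
      exact mem_orbit_self _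
  refine Nat.card_congr (Quotient.congrRight fun x y => ?_)
  rw [orbitRel_apply, orbitRel_apply]
  constructor
  · rintro ⟨⟨g, hg⟩, rfl⟩
    exact key g hg y
  · rintro ⟨⟨g, hg⟩, rfl⟩
    exact mem_orbit y (⟨g, (Subgroup.zpowers_le.mpr (Subgroup.subset_closure hp)) hg⟩ :
      Subgroup.closure s)

/-- **Template D/E (aligned triples violate the certificate).**  If `q₁` and `q₃` preserve every cycle
of `q₂` (map each point into its `⟨q₂⟩`-orbit) and `q₃` has no more cycles than `q₂` — for instance
`q₂, q₃` have the same cycle partition and `q₁` is supported inside its blocks, or all three share one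
cycle partition — then `orb⟨q₁,q₂,q₃⟩ = cyc q₂` and the genus certificate
`n + 2·orb < cyc q₁ + cyc q₂ + cyc q₃` fails (it would force `n < cyc q₁`). -/
theorem not_genusCertificate_of_aligned (q₁ q₂ q₃ : Equiv.Perm (Fin n))
    (h₁ : ∀ x : Fin n, q₁ x ∈ orbit (Subgroup.zpowers q₂) x)
    (h₃ : ∀ x : Fin n, q₃ x ∈ orbit (Subgroup.zpowers q₂) x)
    (h₃₂ : Nat.card (orbitRel.Quotient (Subgroup.zpowers q₃) (Fin n)) ≤
      Nat.card (orbitRel.Quotient (Subgroup.zpowers q₂) (Fin n))) :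
    ¬ (n + 2 * Nat.card (orbitRel.Quotient
        (Subgroup.closure ({q₁, q₂, q₃} : Set (Equiv.Perm (Fin n)))) (Fin n)) <
      Nat.card (orbitRel.Quotient (Subgroup.zpowers q₁) (Fin n)) +
      Nat.card (orbitRel.Quotient (Subgroup.zpowers q₂) (Fin n)) +
      Nat.card (orbitRel.Quotient (Subgroup.zpowers q₃) (Fin n))) := by
  have horb : Nat.card (orbitRel.Quotient
        (Subgroup.closure ({q₁, q₂, q₃} : Set (Equiv.Perm (Fin n)))) (Fin n)) =
      Nat.card (orbitRel.Quotient (Subgroup.zpowers q₂) (Fin n)) := by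
    refine card_orbitQuotient_closure_eq_of_forall_mem_orbit (by simp) ?_
    intro q hq x
    simp only [Set.mem_insert_iff, Set.mem_singleton_iff] at hq
    rcases hq with rfl | rfl | rfl
    · exact h₁ x
    · exact apply_mem_orbit_zpowers q x
    · exact h₃ x
  have hle := card_orbitQuotient_le (n := n) (Subgroup.zpowers q₁)
  rw [horb]
  omega

/-- **Template D/E for sets.**  In a genus-certified triple `(S, T, U)` (the fourth conjunct of
`stub_genusThreshold`), whenever non-trivial quotients `q₁ = s s'⁻¹` of `S` and `q₃ = u u'⁻¹` of `U`
both preserve every cycle of a non-trivial quotient `q₂ = t t'⁻¹` of `T`, the `U`-quotient has strictly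
more cycles than `q₂`.  In particular no quotient of `S` and quotient of `U` share the cycle partition of
a quotient of `T` (and, permuting roles by `Set.insert_comm`, no two quotients from different sets share a
cycle partition while a quotient of the third set lives inside its blocks). -/
theorem genusCertificate_cyc_lt_of_aligned {S T U : Finset (Equiv.Perm (Fin n))}
    (h3 : ∀ s ∈ S, ∀ s' ∈ S, ∀ t ∈ T, ∀ t' ∈ T, ∀ u ∈ U, ∀ u' ∈ U, s ≠ s' → t ≠ t' → u ≠ u' →
      n + 2 * Nat.card (orbitRel.Quotient (Subgroup.closure
        ({s * s'⁻¹, t * t'⁻¹, u * u'⁻¹} : Set (Equiv.Perm (Fin n)))) (Fin n)) <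
      Nat.card (orbitRel.Quotient (Subgroup.zpowers (s * s'⁻¹)) (Fin n)) +
      Nat.card (orbitRel.Quotient (Subgroup.zpowers (t * t'⁻¹)) (Fin n)) +
      Nat.card (orbitRel.Quotient (Subgroup.zpowers (u * u'⁻¹)) (Fin n)))
    {s s' t t' u u' : Equiv.Perm (Fin n)} (hs : s ∈ S) (hs' : s' ∈ S) (ht : t ∈ T) (ht' : t' ∈ T)
    (hu : u ∈ U) (hu' : u' ∈ U) (hss : s ≠ s') (htt : t ≠ t') (huu : u ≠ u')
    (h₁ : ∀ x : Fin n, (s * s'⁻¹) x ∈ orbit (Subgroup.zpowers (t * t'⁻¹)) x)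
    (h₃ : ∀ x : Fin n, (u * u'⁻¹) x ∈ orbit (Subgroup.zpowers (t * t'⁻¹)) x) :
    Nat.card (orbitRel.Quotient (Subgroup.zpowers (t * t'⁻¹)) (Fin n)) <
      Nat.card (orbitRel.Quotient (Subgroup.zpowers (u * u'⁻¹)) (Fin n)) := by
  by_contra hle
  exact not_genusCertificate_of_aligned (s * s'⁻¹) (t * t'⁻¹) (u * u'⁻¹) h₁ h₃ (not_lt.mp hle)
    (h3 s hs s' hs' t ht t' ht' u hu u' hu' hss htt huu)

/-- **N1 for sets.**  In a genus-certified triple every triple of non-trivial quotients has at least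
`n + 3` cycles in total: `cyc(s s'⁻¹) + cyc(t t'⁻¹) + cyc(u u'⁻¹) ≥ n + 3`. -/
theorem genusCertificate_three_le_cyc_add {S T U : Finset (Equiv.Perm (Fin n))}
    (h3 : ∀ s ∈ S, ∀ s' ∈ S, ∀ t ∈ T, ∀ t' ∈ T, ∀ u ∈ U, ∀ u' ∈ U, s ≠ s' → t ≠ t' → u ≠ u' →
      n + 2 * Nat.card (orbitRel.Quotient (Subgroup.closure
        ({s * s'⁻¹, t * t'⁻¹, u * u'⁻¹} : Set (Equiv.Perm (Fin n)))) (Fin n)) <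
      Nat.card (orbitRel.Quotient (Subgroup.zpowers (s * s'⁻¹)) (Fin n)) +
      Nat.card (orbitRel.Quotient (Subgroup.zpowers (t * t'⁻¹)) (Fin n)) +
      Nat.card (orbitRel.Quotient (Subgroup.zpowers (u * u'⁻¹)) (Fin n)))
    {s s' t t' u u' : Equiv.Perm (Fin n)} (hs : s ∈ S) (hs' : s' ∈ S) (ht : t ∈ T) (ht' : t' ∈ T)
    (hu : u ∈ U) (hu' : u' ∈ U) (hss : s ≠ s') (htt : t ≠ t') (huu : u ≠ u') :
    n + 3 ≤ Nat.card (orbitRel.Quotient (Subgroup.zpowers (s * s'⁻¹)) (Fin n)) +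
      Nat.card (orbitRel.Quotient (Subgroup.zpowers (t * t'⁻¹)) (Fin n)) +
      Nat.card (orbitRel.Quotient (Subgroup.zpowers (u * u'⁻¹)) (Fin n)) :=
  three_le_cyc_add _ _ _ (h3 s hs s' hs' t ht t' ht' u hu u' hu' hss htt huu)

end Summit.MatrixMultiplication.MatrixMultiplication.Theorems.ThresholdSubsetTriples.Negative
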